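import Summits.BirchSwinnertonDyer.BirchSwinnertonDyer.Theorems.ByReductionTypeAtTwoEulerCharFormalKummer
import Literature.NumberTheory.GaloisRepresentations.KummerIdeleIndex
import HarnessLib

/-!
# Route `ByReductionTypeAtTwo` (K4), TOWER road — Lemma 3.4 at layer `0`, the LOWER half reduced to a local `H²`:
# `#H²(ℚ_v, Ê[p^k]) ≤ #(Ê(𝔪_∞)/(g−1))[p^∞]` (Coates–Greenberg + Kummer + Tate's Euler–Poincaré formula)

Cell `bsd-2adic`, seat `bsd-2adic-tower-1` (GEN 25), `--supports stmt-BirchSwinnertonDyer-19271` (helper). TOOL theorem only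
(no definition, no named fact, no `sorry`); closes nothing by itself; BSD is not proved by any of this. Part (f) of the
programme «Greenberg LNM 1716 Lemma 3.4 at layer `0` EXACT ⇒ Thm. 4.1 over `ℚ` ⇒ the `hEC` binder of the TOWER doors in the
kernel» (siblings `…EulerCharLayerZero/CoinvExact/CoinvInput/Devissage/ReductionCount/Assembly/FormalBound.lean`).

After `…EulerCharFormalBound` the exact count `#𝒦_{v,0}[p^∞] = (p^{ord_p #Ẽ(𝔽_p)})²` is reduced to the LOWER bound
`p^{ord_p #Ẽ(𝔽_p)} ≤ #(M₁/(g−1)M₁)[p^∞]` on the formal-group coinvariants (`M₁ = Ê(𝔪̄)^{H_∞}`), Greenberg's factor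
`[Im λ_v : Im κ_v] = #Ẽ(𝔽_p)_p = #H¹(ℚ_p, Ê(𝔪̄))` (p. 89). This file proves the cohomological heart of that bound: for the
formal-group torsion `Z = C_k = Ê[p^k]` (cyclic of order `p^k`) with any continuous representation `ρ` of `Γ = Γ_{ℚ_v}` acting as
Galois, **`#H²(Γ, Z) ≤ #(M₁/(g−1)M₁)[p^∞]`**. Proof: every class `[φ] ∈ H¹(Γ, Z)` restricts on `H_∞` to the coboundary of a
point `e` of the formal group (Coates–Greenberg `H¹(H_∞, Ê(𝔪̄)) = 0`, `H1_goodModelKernel_trivial_holds`), so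
`x_φ = φ(g) − (g e − e) ∈ M₁` has a `p^k`-torsion class in `M₁/(g−1)M₁`; two classes with the same image differ by the Kummer
class of a point of `A₀ = E₁(ℚ_v)` (the evaluation injectivity `exists_addMonoidHom_subgroupResKer_injective` and the Hensel lift
`exists_fixed_localRed_eq`), and the Kummer classes are at most `#(A₀/p^k A₀) = p^k · #A₀[p^k]` in number (Lutz,
`natCard_quotient_nsmul_fixedKernel_eq` / `natCard_quotient_nsmul_pow_eq`); hence `#H¹(Γ, Z) ≤ #(M₁/(g−1)M₁)[p^∞] · p^k · #Z^Γ`, and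
Tate's Euler–Poincaré formula `#Z^Γ · #H²(Γ,Z) · p^k = #H¹(Γ,Z)` (`localEP_rat`) cancels to the claim. What then remains of
Lemma 3.4 at layer `0` is purely about the finite module `Z`: `p^{min(k, ord_p #Ẽ(𝔽_p))} ≤ #H²(Γ, Ê[p^k])` (Tate duality
`natCard_two_eq_natCard_invariants_homRep` and the Weil pairing on the ordinary line).

References: [GreenbergLNM1716] §2 Props. 2.2–2.4 (pp. 72–75), §3 Lemma 3.4 (p. 89); [CoatesGreenberg1996] Cor. 3.2;
[MilneADT2006] I Thm. 2.8; [SilvermanAEC2009] VII.2.1–2.2.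
-/

set_option autoImplicit false
-- the Theorems namespace of this sub repeats the summit name by design (D-0017 nested layout: Summit.<S>.<Sub>)
set_option linter.dupNamespace false

noncomputable section

open scoped Classical NNReal ValuativeRel

universe u

namespace Summit.BirchSwinnertonDyer.BirchSwinnertonDyer.Theorems.GoodOrdTower

open CategoryTheory NumberField IsDedekindDomain Field _root_.TopRep _root_.ContinuousCohomology
  Literature.NumberTheory.EllipticCurves Literature.NumberTheory.GaloisRepresentations IsDedekindDomain.HeightOneSpectrum
  Literature.NumberTheory.EllipticCurves.FormalGroupChart Literature.NumberTheory.EllipticCurves.ResKernel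
  Literature.NumberTheory.EllipticCurves.Rank1Residual Literature.NumberTheory.EllipticCurves.CoatesGreenberg1996
  WeierstrassCurve Rat.HeightOneSpectrum

variable {p : ℕ} [hp : Fact p.Prime] {κ : ZpExtension ℚ p}

/-- `#(𝒪[ℚ_v] ⧸ m) = #(ℤ_v ⧸ m)` for `m : ℕ` (the two valuation rings have the same elements; copy of the private helper of
`…GoodOrdTowerControlLayerFormalP`). [folklore] -/
private theorem natCard_integer_quotient_natCast_eq₃ (v : HeightOneSpectrum (𝓞 ℚ)) (m : ℕ) :
    Nat.card ((ValuativeRel.valuation (v.adicCompletion ℚ)).integer ⧸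
        Ideal.span {((m : ℕ) : (ValuativeRel.valuation (v.adicCompletion ℚ)).integer)}) =
      Nat.card (Valued.integer (v.adicCompletion ℚ) ⧸
        Ideal.span {((m : ℕ) : Valued.integer (v.adicCompletion ℚ))}) := by
  have hO : (ValuativeRel.valuation (v.adicCompletion ℚ)).integer = Valued.integer (v.adicCompletion ℚ) := by
    ext x
    rw [Valuation.mem_integer_iff, adicCompletion_valuation_le_one_iff ℚ v x,
      Valuation.mem_integer_iff, Valued.toNormedField.norm_le_one_iff]
  let e : (ValuativeRel.valuation (v.adicCompletion ℚ)).integer ≃+* Valued.integer (v.adicCompletion ℚ) :=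
    RingEquiv.subringCongr hO
  have hIJ : Ideal.span {((m : ℕ) : Valued.integer (v.adicCompletion ℚ))} =
      (Ideal.span {((m : ℕ) : (ValuativeRel.valuation (v.adicCompletion ℚ)).integer)}).map
        (e : (ValuativeRel.valuation (v.adicCompletion ℚ)).integer →+* _) := by
    rw [Ideal.map_span, Set.image_singleton, map_natCast]
  exact Nat.card_congr (Ideal.quotientEquiv _ _ e hIJ).toEquiv

set_option maxHeartbeats 6400000 in
/-- **`#H²(Γ_{ℚ_v}, Ê[p^k]) ≤ #(Ê(𝔪_∞)/(g−1))[p^∞]`** at the package level of `…EulerCharAssembly` (`W/ℚ` globally minimal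
and elliptic with `GoodOrd W p`, `κ` cyclotomic, `v ∋ p`, `w` spectral, `red₀` the reduction of `W_ℤ ⊗ 𝒪_w`, `g ∈ H_0`
generating `H_0` with `H_∞`, `M₁ = E(K̄_v)^{H_∞} ∩ ker red₀`, `D₁ = g − 1`), for the formal-group torsion
`Z = ker red₀ ∩ E(K̄_v)[p^k]` (`hZ`) and ANY continuous representation `ρ` of `Γ_{ℚ_v}` on `Z` acting as Galois (`hρ`):
`Nat.card (H²(ρ)) ≤ #(M₁/D₁M₁)[p^∞]`. See the module docstring for the proof (Coates–Greenberg, evaluation injectivity, Kummer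
classes counted by Lutz, Tate's Euler–Poincaré formula). [cite: GreenbergLNM1716, §3 Lemma 3.4 (p. 89); §2 pp. 72–75]
[cite: CoatesGreenberg1996, Cor. 3.2] [cite: MilneADT2006, I Thm. 2.8] -/
theorem natCard_H2_formalTorsion_le_formalCoinv (hκ : κ.IsCyclotomic) (v : HeightOneSpectrum (𝓞 ℚ))
    (hpv : ((p : ℕ) : 𝓞 ℚ) ∈ v.asIdeal) (W : WeierstrassCurve ℚ) [W.IsGloballyMinimal] [W.IsElliptic] (hgo : GoodOrd W p)
    {w : Valuation (AlgebraicClosure (v.adicCompletion ℚ)) ℝ≥0}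
    (hw : ∀ x, (w x : ℝ) = spectralNorm (v.adicCompletion ℚ) (AlgebraicClosure (v.adicCompletion ℚ)) x)
    (red₀ : localPoints W (v.adicCompletion ℚ) →+
      (((integralModelInt W).map (algebraMap ℤ ↥w.valuationSubring)).map
        (IsLocalRing.residue ↥w.valuationSubring)).toAffine.Point)
    (hred₀ : ∀ P : localPoints W (v.adicCompletion ℚ), red₀ P =
      ((integralModelInt W).map (algebraMap ℤ ↥w.valuationSubring)).reducePoint
        (Affine.Point.congrEquiv (localIntModel_baseChange W w.valuationSubring).symm P))
    {g : absoluteGaloisGroup (v.adicCompletion ℚ)}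
    (hgen : ∀ U : Subgroup (absoluteGaloisGroup (v.adicCompletion ℚ)),
      IsOpen (U : Set (absoluteGaloisGroup (v.adicCompletion ℚ))) →
        localSubgroup κ.kerSubgroup (v.adicCompletion ℚ) ≤ U → g ∈ U →
          localSubgroup (κ.layerSubgroup 0) (v.adicCompletion ℚ) ≤ U)
    (M₁ : AddSubgroup (localPoints W (v.adicCompletion ℚ)))
    (hM₁ : ∀ a, a ∈ M₁ ↔ a ∈ red₀.ker ∧ ∀ h ∈ localSubgroup κ.kerSubgroup (v.adicCompletion ℚ), h • a = a)
    (D₁ : M₁ →+ M₁) (hD₁ : ∀ a : M₁, ((D₁ a : M₁) : localPoints W (v.adicCompletion ℚ)) = g • (a : _) - a)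
    [Finite (AddCommGroup.primaryComponent (M₁ ⧸ D₁.range) p)]
    (k : ℕ) (Z : AddSubgroup (localPoints W (v.adicCompletion ℚ)))
    (hZ : ∀ a, a ∈ Z ↔ red₀ a = 0 ∧ p ^ k • a = 0)
    (ρ : ContinuousRep (absoluteGaloisGroup (v.adicCompletion ℚ)) ℤ Z)
    (hρ : ∀ (σ : absoluteGaloisGroup (v.adicCompletion ℚ)) (z : Z),
      ((ρ σ z : Z) : localPoints W (v.adicCompletion ℚ)) = σ • (z : localPoints W (v.adicCompletion ℚ))) :
    Finite (continuousCohomology 2 ρ.toTopRep) ∧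
      Nat.card (continuousCohomology 2 ρ.toTopRep) ≤ Nat.card (AddCommGroup.primaryComponent (M₁ ⧸ D₁.range) p) := by
  -- notation and the local data (as in `…EulerCharFormalBound`)
  let K := v.adicCompletion ℚ
  let Pt : Type := localPoints W K
  let Γ := absoluteGaloisGroup K
  let Qp := AddCommGroup.primaryComponent (M₁ ⧸ D₁.range) p
  have hord : W.HasGoodReductionAtPrime p ∧ ¬ ((p : ℕ) : ℤ) ∣ W.frobeniusTrace p := hgo
  have hΔ : ¬ ((p : ℕ) : ℤ) ∣ minimalDiscriminantInt W :=
    W.not_dvd_minimalDiscriminantInt_of_hasGoodReductionAtPrime' p hord.1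
  have hap := hord.2
  have hvO : w.Integers w.valuationSubring := Valuation.valuationSubring.integers w
  have hΔu := W.isUnit_Δ_localIntModel hpv hw hΔ
  have hpO : w ((p : ℕ) : AlgebraicClosure K) < 1 := by
    have h := spectralValuation_algebraMap_ringOfIntegers_lt_one (v := v) hw hpv
    rwa [map_natCast] at h
  haveI hchar : CharP (IsLocalRing.ResidueField ↥w.valuationSubring) p := by
    refine (CharP.charP_iff_prime_eq_zero hp.out).mpr ?_
    rw [← map_natCast (IsLocalRing.residue ↥w.valuationSubring), IsLocalRing.residue_eq_zero_iff,
      IsLocalRing.mem_maximalIdeal, mem_nonunits_iff, hvO.isUnit_iff_valuation_eq_one, map_natCast]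
    exact ne_of_lt hpO
  haveI hV : (W.baseChange (AlgebraicClosure (v.adicCompletion ℚ))).IsIntegral w.integer :=
    ⟨⟨(integralModelInt W).map (algebraMap ℤ ↥w.integer), W.baseChange_eq_localIntModel_integer_baseChange⟩⟩
  have hϖ : Irreducible ((p : ℕ) : v.adicCompletionIntegers ℚ) := irreducible_natCast_adicCompletionIntegers_rat hpv
  have hordA := W.exists_zsmul_eq_zero_localRed_ne_zero hw hΔu red₀ hred₀ hpv hΔ hap
  obtain ⟨hgenr, -, -⟩ := W.localRed_ordinary_filtration hΔu red₀ hred₀ hordA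
  have hker : ∀ Q : localPoints W (v.adicCompletion ℚ), red₀ Q = 0 ↔
      (Q : (W.baseChange (AlgebraicClosure (v.adicCompletion ℚ))).toAffine.Point) ∈
        kernel w (W.baseChange (AlgebraicClosure (v.adicCompletion ℚ))) := fun Q ↦
    W.localRed_eq_zero_iff_mem_kernel hΔu red₀ hred₀ Q
  have hmem0 : ∀ σ : Γ, σ ∈ localSubgroup (κ.layerSubgroup 0) K := fun σ ↦ by
    rw [mem_localSubgroup_iff, ZpExtension.layerSubgroup_zero]; exact Subgroup.mem_top _
  have hρΓ : ∀ (σ : Γ) (z : Z), (((ρ.toTopRep).ρ σ z : Z) : Pt) = σ • (z : Pt) := fun σ z ↦ hρ σ z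
  -- the Kummer classes of `A₀ = E₁(ℚ_v)`
  let A₀ : AddSubgroup (localPoints W (v.adicCompletion ℚ)) :=
    red₀.ker ⊓ FixedPoints.addSubgroup (localSubgroup (κ.layerSubgroup 0) (v.adicCompletion ℚ)) (localPoints W (v.adicCompletion ℚ))
  have hA₀ : ∀ a, a ∈ A₀ ↔ a ∈ red₀.ker ∧ ∀ σ ∈ localSubgroup (κ.layerSubgroup 0) (v.adicCompletion ℚ), σ • a = a :=
      fun a ↦ by
    change a ∈ red₀.ker ⊓ FixedPoints.addSubgroup _ (localPoints W (v.adicCompletion ℚ)) ↔ _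
    rw [AddSubgroup.mem_inf, FixedPoints.mem_addSubgroup]
    exact ⟨fun ⟨h1, h2⟩ ↦ ⟨h1, fun σ hσ ↦ h2 ⟨σ, hσ⟩⟩, fun ⟨h1, h2⟩ ↦ ⟨h1, fun σ ↦ h2 σ σ.2⟩⟩
  have hA₀fix : ∀ a ∈ A₀, ∀ σ : Γ, σ • a = a := fun a ha σ ↦ ((hA₀ a).mp ha).2 σ (hmem0 σ)
  -- COUNTING. Tate's Euler–Poincaré formula for `ρ`
  obtain ⟨Pk, hPk0, hPkord, hPkgen⟩ := hgenr k
  have hPk2 : p ^ k • Pk = 0 := by rw [← hPkord]; exact addOrderOf_nsmul_eq_zero Pk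
  have hZcard : Nat.card Z = p ^ k := by
    let Pz : Z := ⟨Pk, (hZ Pk).mpr ⟨hPk0, hPk2⟩⟩
    have hPzord : addOrderOf Pz = p ^ k := by rw [← AddSubgroup.addOrderOf_coe Pz]; exact hPkord
    have h : (AddSubgroup.zmultiples Pz : AddSubgroup Z) = ⊤ := by
      rw [eq_top_iff]
      intro z _
      obtain ⟨c, hc⟩ := hPkgen z ((hZ _).mp z.2).1 (by rw [natCast_zsmul]; exact ((hZ _).mp z.2).2)
      have : z = c • Pz := Subtype.ext (by rw [AddSubmonoidClass.coe_nsmul]; exact hc)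
      exact this ▸ AddSubgroup.nsmul_mem _ (AddSubgroup.mem_zmultiples Pz) c
    rw [← hPzord, ← Nat.card_zmultiples Pz, h, AddSubgroup.card_top]
  haveI hZfin : Finite Z := Nat.finite_of_card_ne_zero (by rw [hZcard]; exact pow_ne_zero k hp.out.ne_zero)
  obtain ⟨hf1, hf2, hEP⟩ := localEP_rat p v hpv ρ
  haveI := hf1
  haveI := hf2
  have hOk : Nat.card ((ValuativeRel.valuation K).integer ⧸
      Ideal.span {((Nat.card Z : ℕ) : (ValuativeRel.valuation K).integer)}) = p ^ k := by
    rw [hZcard, natCard_integer_quotient_natCast_eq₃ v (p ^ k)]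
    have hT : ∀ v' : HeightOneSpectrum (𝓞 ℚ), ((p ^ k : ℕ) : 𝓞 ℚ) ∈ v'.asIdeal → v' ∈ ({v} : Finset _) := by
      intro v' hv'
      rw [Finset.mem_singleton]
      have hv'p : ((p : ℕ) : 𝓞 ℚ) ∈ v'.asIdeal := by
        rw [Nat.cast_pow] at hv'
        exact v'.isPrime.mem_of_pow_mem _ hv'
      apply (Rat.HeightOneSpectrum.primesEquiv (R := 𝓞 ℚ)).injective
      exact Subtype.ext ((Rat.HeightOneSpectrum.primesEquiv_eq_of_natCast_mem v' hp.out hv'p).trans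
        (Rat.HeightOneSpectrum.primesEquiv_eq_of_natCast_mem v hp.out hpv).symm)
    have h := prod_natCard_integer_quotient_natCast (K := ℚ) (pow_ne_zero k hp.out.ne_zero) hT
    rw [Finset.prod_singleton, Module.finrank_self, pow_one] at h
    exact h
  rw [hOk] at hEP
  -- Lutz for `A₀` at depth `p^k`
  haveI := MultTowerNS2.finiteDimensional_fixedField_localSubgroup_layerSubgroup (κ := κ) v 0
  haveI hVL : (W.baseChange (IntermediateField.fixedField (localSubgroup (κ.layerSubgroup 0) (v.adicCompletion ℚ)) : IntermediateField (v.adicCompletion ℚ) (AlgebraicClosure (v.adicCompletion ℚ)))).IsIntegral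
      (w.comap (algebraMap (IntermediateField.fixedField (localSubgroup (κ.layerSubgroup 0) (v.adicCompletion ℚ)) : IntermediateField (v.adicCompletion ℚ) (AlgebraicClosure (v.adicCompletion ℚ))) (AlgebraicClosure (v.adicCompletion ℚ)))).integer := by
    refine ⟨⟨(integralModelInt W).map (algebraMap ℤ _), ?_⟩⟩
    conv_lhs => rw [← map_integralModelInt W]
    rw [baseChange, baseChange, WeierstrassCurve.map_map, WeierstrassCurve.map_map]
    congr 1
    exact RingHom.ext_int _ _
  have hfr := MultTowerNS2.finrank_fixedField_localSubgroup_layerSubgroup hκ v hpv 0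
  have hAH : ∀ Q : localPoints W (v.adicCompletion ℚ), Q ∈ A₀ ↔
      (Q : (W.baseChange (AlgebraicClosure (v.adicCompletion ℚ))).toAffine.Point) ∈
        kernel w (W.baseChange (AlgebraicClosure (v.adicCompletion ℚ))) ∧
        ∀ σ ∈ localSubgroup (κ.layerSubgroup 0) (v.adicCompletion ℚ), σ • Q = Q := fun Q ↦ by
    rw [hA₀, AddMonoidHom.mem_ker, hker Q]
  obtain ⟨hfinq, -, hLutz⟩ := natCard_quotient_nsmul_fixedKernel_eq (K := ℚ) (v := v) hw hpv W
    (localSubgroup (κ.layerSubgroup 0) (v.adicCompletion ℚ)) A₀ hAH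
  haveI := hfinq
  have hO1 : Nat.card (v.adicCompletionIntegers ℚ ⧸ Ideal.span {((p : ℕ) : v.adicCompletionIntegers ℚ)}) = p := by
    rw [← (IsDiscreteValuationRing.irreducible_iff_uniformizer _).mp hϖ]
    change Nat.card (IsLocalRing.ResidueField (v.adicCompletionIntegers ℚ)) = p
    rw [natCard_residueField_adicCompletionIntegers v, Rat.HeightOneSpectrum.primesEquiv_eq_of_natCast_mem v hp.out hpv]
  have hfinj : ∀ j : ℕ, Finite (nsmulAddMonoidHom (p ^ j) : A₀ →+ A₀).ker := by
    intro j
    obtain ⟨Pj, hPj0, hPjord, hPjgen⟩ := hgenr j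
    haveI : Finite (AddSubgroup.zmultiples Pj) := Nat.finite_of_card_ne_zero (by
      rw [Nat.card_zmultiples, hPjord]; exact pow_ne_zero j hp.out.ne_zero)
    refine Finite.of_injective (fun a : (nsmulAddMonoidHom (p ^ j) : A₀ →+ A₀).ker ↦
      (⟨((a : A₀) : Pt), ?_⟩ : AddSubgroup.zmultiples Pj)) fun a b hab ↦ ?_
    · have ha := a.2
      rw [AddMonoidHom.mem_ker, nsmulAddMonoidHom_apply] at ha
      have ha' : p ^ j • ((a : A₀) : Pt) = 0 := by
        have h := congrArg (fun y : A₀ ↦ (y : Pt)) ha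
        simpa only [AddSubmonoidClass.coe_nsmul, ZeroMemClass.coe_zero] using h
      obtain ⟨c, hc⟩ := hPjgen _ ((AddMonoidHom.mem_ker).mp ((hA₀ _).mp (a : A₀).2).1)
        (by rw [natCast_zsmul]; exact ha')
      rw [hc]
      exact AddSubgroup.nsmul_mem _ (AddSubgroup.mem_zmultiples Pj) c
    · exact Subtype.ext (Subtype.ext (congrArg (fun y : AddSubgroup.zmultiples Pj ↦ (y : Pt)) hab))
  obtain ⟨hfinqk, hE⟩ := natCard_quotient_nsmul_pow_eq (A := A₀) p _ hfinj hLutz k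
  haveI := hfinqk
  rw [hO1, hfr, pow_zero, pow_one] at hE
  -- invariants of `ρ` = `A₀[p^k]`
  have hinv : Nat.card ρ.toTopRep.ρ.invariants = Nat.card (nsmulAddMonoidHom (p ^ k) : A₀ →+ A₀).ker := by
    refine Nat.card_congr ?_
    exact
      { toFun := fun z ↦ ⟨⟨((z.1 : Z) : Pt), (hA₀ _).mpr ⟨(AddMonoidHom.mem_ker).mpr ((hZ _).mp z.1.2).1,
            fun σ _ ↦ by
              have h := z.2 σ
              have h' := congrArg (fun y : Z ↦ (y : Pt)) h
              rw [hρΓ] at h'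
              exact h'⟩⟩,
          by
            rw [AddMonoidHom.mem_ker, nsmulAddMonoidHom_apply]
            exact Subtype.ext (by rw [AddSubmonoidClass.coe_nsmul, ZeroMemClass.coe_zero]; exact ((hZ _).mp z.1.2).2)⟩
        invFun := fun a ↦ ⟨⟨((a.1 : A₀) : Pt), (hZ _).mpr ⟨(AddMonoidHom.mem_ker).mp ((hA₀ _).mp a.1.2).1, by
            have h := a.2
            rw [AddMonoidHom.mem_ker, nsmulAddMonoidHom_apply] at h
            have h' := congrArg (fun y : A₀ ↦ (y : Pt)) h
            simpa only [AddSubmonoidClass.coe_nsmul, ZeroMemClass.coe_zero] using h'⟩⟩,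
          fun σ ↦ Subtype.ext (by rw [hρΓ]; exact hA₀fix _ a.1.2 σ)⟩
        left_inv := fun z ↦ Subtype.ext (Subtype.ext rfl)
        right_inv := fun a ↦ Subtype.ext (Subtype.ext rfl) }
  -- step 1 (`…EulerCharFormalKummer`): `#H¹ ≤ #Qp · #(A₀/p^k)`
  have hcard1 := natCard_H1_formalTorsion_le_mul hκ v hpv W hgo hw red₀ hred₀ hgen M₁ hM₁ D₁ hD₁ k Z hZ ρ hρ
  -- assemble: `#Z^Γ · #H² · p^k = #H¹ ≤ #Qp · p^k · #Z^Γ`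
  refine ⟨hf2, ?_⟩
  have hpos : 0 < Nat.card ρ.toTopRep.ρ.invariants * p ^ k :=
    Nat.mul_pos Nat.card_pos (pow_pos hp.out.pos k)
  have h := hcard1
  rw [← hEP, hE, hinv] at h
  -- h : #inv * #H2 * p^k ≤ #Qp * (p^k * #inv)
  have h' : Nat.card (continuousCohomology 2 ρ.toTopRep) * (Nat.card ρ.toTopRep.ρ.invariants * p ^ k) ≤
      Nat.card Qp * (Nat.card ρ.toTopRep.ρ.invariants * p ^ k) := by
    rw [hinv]
    calc Nat.card (continuousCohomology 2 ρ.toTopRep) * (Nat.card (nsmulAddMonoidHom (p ^ k) : A₀ →+ A₀).ker * p ^ k)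
        = Nat.card (nsmulAddMonoidHom (p ^ k) : A₀ →+ A₀).ker * Nat.card (continuousCohomology 2 ρ.toTopRep) * p ^ k := by
          ring
      _ ≤ Nat.card Qp * (p ^ k * Nat.card (nsmulAddMonoidHom (p ^ k) : A₀ →+ A₀).ker) := h
      _ = Nat.card Qp * (Nat.card (nsmulAddMonoidHom (p ^ k) : A₀ →+ A₀).ker * p ^ k) := by ring
  exact Nat.le_of_mul_le_mul_right h' hpos

end Summit.BirchSwinnertonDyer.BirchSwinnertonDyer.Theorems.GoodOrdTower

end
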